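import Literature.AlgebraicGeometry.AbelianVarieties.SymmetricAmpleH1Vanishing
import Literature.AlgebraicGeometry.Modules.CechMH1ToExtOne
import Literature.AlgebraicGeometry.Modules.SerreVanishingAmpleMultiples
import HarnessLib

/-!
# `H¹(A, 𝒪_A(Θ)) = 0` and `Ext¹_{𝒪_A}(𝒪_A, 𝒪_A(Θ)) = 0` for a SYMMETRIC AMPLE divisor `Θ` on an abelian variety over any field
# (Mumford, *Abelian Varieties*, §16 «the vanishing theorem» — degree one, symmetric case; assembled from the `[n]`-trick and Serre)

Layer `Literature/AlgebraicGeometry/AbelianVarieties`, namespace `Literature.AlgebraicGeometry.Motives.AbelianVariety`.  THEOREMS ONLY (no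
definition, no named fact, no instance, no `sorry`).  The ★ EDITION of the cell's brick V3 (F-DAG leaf F-2 (b) FIELD CASE of [MFK94] Prop. 6.13,
road of record «`[n]`-trick», B-plan1 (g16) 2026-08-30T07:21:48Z): the three inputs

* ★ V3a `AbelianVarieties/SymmetricAmpleH1Vanishing` — `Ȟ¹(𝒰, 𝒪(Θ)) = 0` for `Θ` symmetric from `Ȟ¹(𝒰, 𝒪(m • Θ)) = 0`, `m ≥ N` (the `[n]`-trick);
* ★ V2 `Modules/SerreVanishingAmpleMultiples` (B-p16 (g15)) — Serre: `Ȟ¹(𝒰, 𝒪(m • Θ)) = 0` for `m ≥ N(Θ, 𝒰)`, `Θ` ample, on a proper integral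
  `k`-scheme ([Hartshorne1977] III Thm. 5.2 (b));
* ★ V5 `Modules/CechMH1ToExtOne` — `Ȟ¹ = 0` on one affine cover ⇒ `H¹ = 0` ⇒ `Ext¹(𝒪, –) = 0`,

assembled on a finite affine open cover of the (quasi-compact) abelian variety:

* **`AbelianVariety.subsingleton_cechMH1_lineBundle_of_symmetric_isAmple`** — `Ȟ¹(𝒰, 𝒪_A(Θ)) = 0` on every finite affine open cover;
* **`AbelianVariety.subsingleton_H_one_lineBundle_of_symmetric_isAmple`** — `H¹(A, 𝒪_A(Θ)) = 0`;
* **`AbelianVariety.subsingleton_ext_one_lineBundle_of_symmetric_isAmple`** — `Ext¹_{𝒪_A}(𝒪_A, 𝒪_A(Θ)) = 0` (the spelling consumed by V4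
  `AbelianSchemes/AbelianSchemeLDeltaFibreH1Vanishing`, B-p11 (g17), at `ι_s̄^*L^Δ(λ)^{⊗3}`).

Any field, any characteristic; `Θ` ample AND symmetric (`(−1)^*Θ ∼ Θ`) — [MumfordAV1970] §16 has all ample `L` and all `H^i`, `i > 0`, over an
algebraically closed field; the symmetric degree-one case is what the (F) embedding package consumes.  Count-neutral; HC_CM is proved only modulo the 7
printed citations until rung 0 closes — nothing here refers to it.

## References
* [MumfordAV1970] D. Mumford, *Abelian Varieties*, TIFR Studies in Mathematics 5 (1970), §16 (the vanishing theorem).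
* [Hartshorne1977] R. Hartshorne, *Algebraic Geometry*, GTM 52 (1977), III Thm. 5.2 (b), III Thm. 4.5, III Ex. 4.4 (c), III Prop. 6.3 (c).
* [GortzWedhorn2023] U. Görtz, T. Wedhorn, *Algebraic Geometry II* (2023), Prop. 27.184 (1), Rem. 27.185, Prop. 27.186.
-/

noncomputable section

universe w v u

open CategoryTheory AlgebraicGeometry TopologicalSpace Opposite

namespace Literature.AlgebraicGeometry.Motives

namespace AbelianVariety

open Literature.AlgebraicGeometry.Morphisms Literature.AlgebraicGeometry.Modules Literature.AlgebraicGeometry.HodgeTheory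

variable {k : Type u} [Field k] (A : AbelianVariety k) (Θ : CartierDivisor A.X.left) (hΘ : Θ.IsAmple)
  (hsym : (Θ.pullback (Hom.toSchemeHom (-𝟙 A))).LinEquiv Θ)

include hΘ hsym

/-- **`Ȟ¹(𝒰, 𝒪_A(Θ)) = 0` for `Θ` symmetric ample**, on every finite affine open cover `𝒰` of an abelian variety over any field: Serre's vanishing
for the multiples `m • Θ`, `m ≥ N` (★ `Modules.exists_forall_subsingleton_cechMH1_lineBundle_nsmul`) fed into the `[n]`-trick
(★ `subsingleton_cechMH1_lineBundle_of_symmetric_of_forall_nsmul`). [cite: MumfordAV1970, §16 (the vanishing theorem)]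
[cite: Hartshorne1977, III Thm. 5.2 (b) and III Thm. 4.5] -/
theorem subsingleton_cechMH1_lineBundle_of_symmetric_isAmple {ι : Type v} [Finite ι] (U : ι → A.X.left.Opens)
    (hU : ∀ i, IsAffineOpen (U i)) (hcov : ⨆ i, U i = ⊤) :
    Subsingleton (CechMH1 A.X.hom (Modules.lineBundle Θ.toUnitCocycle) U) := by
  obtain ⟨N, hN⟩ := Modules.exists_forall_subsingleton_cechMH1_lineBundle_nsmul A.X Θ hΘ U hU hcov
  exact A.subsingleton_cechMH1_lineBundle_of_symmetric_of_forall_nsmul Θ hsym U hU hcov N fun m hm => hN m hm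

/-- **`H¹(A, 𝒪_A(Θ)) = 0` for `Θ` symmetric ample** on an abelian variety over any field (sheaf cohomology of the underlying abelian sheaf):
a finite affine open cover of the quasi-compact `A`, the previous theorem, and ★ `subsingleton_H_one_of_subsingleton_cechMH1`.
[cite: MumfordAV1970, §16 (the vanishing theorem)] [cite: Hartshorne1977, III Ex. 4.4 (c) and III Thm. 4.5] -/
theorem subsingleton_H_one_lineBundle_of_symmetric_isAmple :
    Subsingleton (((modulesToSheaf A.X.left).obj (Modules.lineBundle Θ.toUnitCocycle)).H 1) := by
  -- a finite affine open cover of the quasi-compact `A`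
  haveI : CompactSpace A.X.left := hΘ.1
  obtain ⟨s, hs, e⟩ := (isCompact_iff_finite_and_eq_biUnion_affineOpens (U := (⊤ : A.X.left.Opens))).mp
    (by simpa using isCompact_univ)
  haveI := hs.to_subtype
  let U : s → A.X.left.Opens := fun i => i.1.1
  have hU : ∀ i, IsAffineOpen (U i) := fun i => i.1.2
  have hcov : ⨆ i, U i = ⊤ := by rw [iSup_subtype]; exact e.symm
  haveI := A.subsingleton_cechMH1_lineBundle_of_symmetric_isAmple Θ hΘ hsym U hU hcov
  exact subsingleton_H_one_of_subsingleton_cechMH1 A.X.hom (Modules.lineBundle Θ.toUnitCocycle)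
    (isAffineLocalizing_of_isFiniteLocallyFree (UnitCocycle.isFiniteLocallyFree_lineBundle _)) U hU hcov

/-- **`Ext¹_{𝒪_A}(𝒪_A, 𝒪_A(Θ)) = 0` for `Θ` symmetric ample** on an abelian variety over any field — the spelling consumed by the
cohomology-and-base-change sockets (`Ext.{1}` at universe `0`). [cite: MumfordAV1970, §16 (the vanishing theorem)]
[cite: Hartshorne1977, III Prop. 6.3 (c), III Ex. 4.4 (c) and III Thm. 4.5] -/
theorem subsingleton_ext_one_lineBundle_of_symmetric_isAmple [HasExt.{w} A.X.left.Modules] :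
    Subsingleton (Abelian.Ext.{w} (unitModule A.X.left) (Modules.lineBundle Θ.toUnitCocycle) 1) := by
  haveI := A.subsingleton_H_one_lineBundle_of_symmetric_isAmple Θ hΘ hsym
  exact subsingleton_ext_unit_of_subsingleton_H _ 1

end AbelianVariety

end Literature.AlgebraicGeometry.Motives

end
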